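import Literature.Computability.AlgebraicComplexity.CircuitCodeModularEvaluator
import Literature.Computability.AlgebraicComplexity.KIReductionValid
import Literature.Computability.AlgebraicComplexity.PermanentLaplaceChain
import HarnessLib

/-!
# Point-segment bricks: writing the evaluation points of the `BIJL18` Thm. 6 verifier in `FP`

The point/modulus evaluator `CircuitCode.evalAtF` (`CircuitCodeModularEvaluator.lean`) reads its
evaluation point off a SEGMENT of `|w|` blocks of `b` bits (`ModularZeroTest.ptOf b |w| seg`:
coordinate `i ↦ ⟦block i⟧`). The `∃·coRP` verifier behind Bläser–Ikenmeyer–Jindal–Lysikov 2018,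
Thm. 6 (Kabanets–Impagliazzo's row-expansion chain checked modulo a guessed prime by random
evaluation, `BIJL18Thm6Verifier.lean`) evaluates guessed codes at three kinds of points, all in the
fixed `n × n` layout of `PermanentLaplaceChain.lean` (matrix entry `(a, c)` at the flat position
`a·n + c`):

* the random matrix `R` itself (coin blocks `T`, `n²` blocks of `b` bits), FITTED to `|w|` blocks —
  `fitSegF ⟨1^V, ⟨1^b, T⟩⟩` (`ptOf_fitSegF`: coordinate `i < n²` is `⟦block i of T⟧`, else `0`);
* the MINOR of `R` along row `0` and column `j`, i.e. the gather of the blocks of `T` at the source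
  positions `PermanentChain.minorSrc n j (i / n) (i % n)` — `minorSegF ⟨1^V, ⟨1^b, ⟨T, ⟨1^n, 1^j⟩⟩⟩⟩`
  (`ptOf_minorSegF`);
* the input `0/1` matrix `A` read off the rows field of the instance (`KIReduction.parsedEntry`) —
  `entrySegF ⟨1^V, ⟨1^b, ⟨rows, 1^n⟩⟩⟩` (`ptOf_entrySegF`: coordinate `i < n²` is
  `parsedEntry rows (i / n) (i % n)`, else `0`).

All three are instances of ONE counted concatenation fold (`Brick.foldLoop appF`, `FoldBricks.lean`)
`segF g ⟨1^V, prm⟩ = g ⟨x, 1⁰⟩ ++ ⋯ ++ g ⟨x, 1^{V-1}⟩` of a `b`-bit block-valued piece `g`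
(`segF_apply`, `segF_mem_FP`), with the block reader `blockAtF ⟨⟨1^b, T⟩, 1^s⟩ =
(T ⇂ s·b ++ 0^b) ↾ b` (block `s` of `T`, or the zero block past the end). Pure plumbing in the
brick algebra; every specification is a total equation.

## References

* S. Arora, B. Barak, *Computational Complexity: A Modern Approach*, CUP 2009, §1.3 (polynomial
  time is closed under composition and bounded loops) [AroraBarakCC2009].
* V. Kabanets, R. Impagliazzo, STOC 2003, Lemma 11 (p. 358) (the minors along the first row)
  [KabanetsImpagliazzo2003].
* M. Bläser, C. Ikenmeyer, G. Jindal, V. Lysikov, STOC 2018 = ECCC TR18-064, §6 [BlaserIkenmeyerJindalLysikov2018].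
-/

noncomputable section

namespace Literature.Computability.AlgebraicComplexity

namespace PointSeg

open _root_.Computability Complexity Brick HashBricks Plumb PRelSigma PRelSigPi ModularZeroTest
open Polynomial

/-! ### Concatenations of equal-length blocks -/

/-- The length of a concatenation of `V` blocks of length `b`. [folklore] -/
private theorem length_ccat_eq {f : ℕ → List Bool} {b : ℕ} : ∀ {V : ℕ}, (∀ j < V, (f j).length = b) →
    (ccat f V).length = V * b
  | 0, _ => by simp
  | V + 1, h => by
    rw [ccat_succ, List.length_append, length_ccat_eq (V := V) fun j hj => h j (by omega), h V (by omega)]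
    ring

/-- Block `k < V` of a concatenation of `V` blocks of length `b` is the `k`-th block. [folklore] -/
private theorem blockOf_ccat {f : ℕ → List Bool} {b : ℕ} : ∀ {V k : ℕ}, (∀ j < V, (f j).length = b) → k < V →
    blockOf b k (ccat f V) = f k
  | 0, _, _, hk => absurd hk (Nat.not_lt_zero _)
  | V + 1, k, h, hk => by
    have hV : (ccat f V).length = V * b := length_ccat_eq fun j hj => h j (by omega)
    rw [ccat_succ, blockOf]
    by_cases hkV : k < V
    · have hle : k * b + b ≤ (ccat f V).length := by
        rw [hV]; have := Nat.mul_le_mul_right b hkV; rw [Nat.succ_mul] at this; omega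
      rw [List.drop_append_of_le_length (by omega), List.take_append_of_le_length (by simp; omega)]
      have := blockOf_ccat (V := V) (fun j hj => h j (by omega)) hkV
      rwa [blockOf] at this
    · obtain rfl : k = V := by omega
      rw [← hV, List.drop_left, ← h k (by omega), List.take_length]

/-! ### One block of a segment -/

/-- **The block reader** on `⟨⟨1^b, T⟩, u⟩`: `(T ⇂ |u|·b ++ 0^b) ↾ b` — block `|u|` of `T` (`b`
bits), or the zero block past the end of `T`. [cite: AroraBarakCC2009, §1.3] -/
def blockAtF : List Bool → List Bool :=
  takeFn ∘ fanoutFn (fstF ∘ fstF)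
    (appF ∘ fanoutFn (dropFn ∘ fanoutFn (umulFn ∘ fanoutFn sndF (fstF ∘ fstF)) (sndF ∘ fstF))
      (Kannan.zerosFn ∘ fstF ∘ fstF))

/-- `blockAtF ∈ FP`. [cite: AroraBarakCC2009, §1.3] -/
theorem blockAtF_mem_FP : blockAtF ∈ FP :=
  comp_mem_FP takeFn_mem_FP (fanoutFn_mem_FP (comp_mem_FP fstF_mem_FP fstF_mem_FP)
    (comp_mem_FP appF_mem_FP (fanoutFn_mem_FP
      (comp_mem_FP dropFn_mem_FP (fanoutFn_mem_FP
        (comp_mem_FP umulFn_mem_FP (fanoutFn_mem_FP sndF_mem_FP (comp_mem_FP fstF_mem_FP fstF_mem_FP)))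
        (comp_mem_FP sndF_mem_FP fstF_mem_FP)))
      (comp_mem_FP Kannan.zerosFn_mem_FP (comp_mem_FP fstF_mem_FP fstF_mem_FP)))))

/-- Value of the block reader. [cite: AroraBarakCC2009, §1.3] -/
theorem blockAtF_apply (bb T u : List Bool) :
    blockAtF (boolPair (boolPair bb T) u) =
      (T.drop (u.length * bb.length) ++ List.replicate bb.length false).take bb.length := by
  simp [blockAtF, umulFn_apply]

/-- The block reader outputs exactly `b` symbols. [cite: AroraBarakCC2009, §1.3] -/
theorem length_blockAtF (bb T u : List Bool) : (blockAtF (boolPair (boolPair bb T) u)).length = bb.length := by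
  rw [blockAtF_apply, List.length_take]
  simp

/-- **Inside `T` the reader returns the block**: if `(s+1)·b ≤ |T|` then block `s`.
[cite: AroraBarakCC2009, §1.3] -/
theorem blockAtF_of_lt (bb T u : List Bool) (h : (u.length + 1) * bb.length ≤ T.length) :
    blockAtF (boolPair (boolPair bb T) u) = blockOf bb.length u.length T := by
  rw [blockAtF_apply, blockOf, List.take_append_of_le_length]
  rw [List.length_drop, Nat.succ_mul] at *
  omega

/-- **Past the end of `T` the reader returns the zero block**: if `|T| ≤ s·b`.
[cite: AroraBarakCC2009, §1.3] -/
theorem blockAtF_of_le (bb T u : List Bool) (h : T.length ≤ u.length * bb.length) :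
    blockAtF (boolPair (boolPair bb T) u) = List.replicate bb.length false := by
  rw [blockAtF_apply, List.drop_eq_nil_of_le h, List.nil_append, List.take_replicate, min_self]

/-- The value of the reader on a string of `m` whole blocks: block `s` if `s < m`, else `0`.
[cite: AroraBarakCC2009, §1.3] -/
theorem bitsToNat_blockAtF {bb T u : List Bool} {m : ℕ} (hT : T.length = m * bb.length) :
    bitsToNat (blockAtF (boolPair (boolPair bb T) u)) =
      if u.length < m then bitsToNat (blockOf bb.length u.length T) else 0 := by
  split_ifs with h
  · rw [blockAtF_of_lt]
    rw [hT]; exact Nat.mul_le_mul_right _ h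
  · rw [blockAtF_of_le _ _ _ (by rw [hT]; exact Nat.mul_le_mul_right _ (not_lt.1 h))]
    induction bb.length with
    | zero => rfl
    | succ k ih => rw [List.replicate_succ]; simp [bitsToNat, ih]

/-! ### The generic segment fold -/

/-- Loop record of the segment fold: `x ↦ ⟨x, ⟨bin |fstF x|, ⟨ε, ε⟩⟩⟩`. [folklore] -/
def segLoopIn : List Bool → List Bool :=
  fanoutFn id (fanoutFn (lenBinF ∘ fstF) (fanoutFn (fun _ => []) (fun _ => [])))

/-- **The segment of a piece `g`**: on `x = ⟨1^V, prm⟩`, the concatenation `g ⟨x, 1⁰⟩ ++ ⋯ ++ g ⟨x, 1^{V-1}⟩`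
(a counted fold `foldLoop appF`, the piece clipped to `|x| + 1` symbols). [cite: AroraBarakCC2009, §1.3] -/
def segF (g : List Bool → List Bool) : List Bool → List Bool :=
  sndPow 2 ∘ foldLoop appF (clipF 1 g) X ∘ segLoopIn

/-- `segF g ∈ FP` for `g ∈ FP`. [cite: AroraBarakCC2009, §1.3] -/
theorem segF_mem_FP {g : List Bool → List Bool} (hg : g ∈ FP) : segF g ∈ FP :=
  comp_mem_FP (sndPow_mem_FP 2) (comp_mem_FP (foldLoop_clipF_mem_FP 1 appF_mem_FP length_appF_le hg X)
    (fanoutFn_mem_FP OracleCompose.id_mem_FP (fanoutFn_mem_FP (comp_mem_FP lenBinF_mem_FP fstF_mem_FP)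
      (fanoutFn_mem_FP (const_mem_FP _) (const_mem_FP _)))))

/-- **Value of the segment fold** on `x = ⟨1^V, prm⟩`, for a piece whose blocks on `x` are at most
`|x| + 1` long. [cite: AroraBarakCC2009, §1.3] -/
theorem segF_apply {g : List Bool → List Bool} {V : ℕ} {prm : List Bool}
    (hg : ∀ j < V, (g (boolPair (boolPair (ones V) prm) (ones j))).length ≤ (boolPair (ones V) prm).length + 1) :
    segF g (boolPair (ones V) prm) = ccat (fun j => g (boolPair (boolPair (ones V) prm) (ones j))) V := by
  have hV : V ≤ X.eval (boolPair (ones V) prm).length := by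
    rw [eval_X, length_boolPair, KIReduction.length_ones']; omega
  rw [segF, Function.comp_apply, Function.comp_apply, segLoopIn]
  simp only [fanoutFn_apply, id, Function.comp_apply, fstF_boolPair, lenBinF_apply, KIReduction.length_ones']
  have key := foldLoop_apply appF (clipF 1 g) hV 0 []
  rw [show ones 0 = [] from rfl, zero_add] at key
  rw [key, foldAcc_clipF (fun j _ hj => by rw [one_mul]; exact hg j (by omega)), foldAcc_appF]
  simp [sndPow]

/-- **Reading the segment of a `b`-bit piece**: length `V·b`, and block `k < V` is the `k`-th piece.
[cite: AroraBarakCC2009, §1.3] -/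
theorem segF_blocks {g : List Bool → List Bool} {V b : ℕ} {prm : List Bool} (hb : b ≤ (boolPair (ones V) prm).length + 1)
    (hg : ∀ j < V, (g (boolPair (boolPair (ones V) prm) (ones j))).length = b) :
    (segF g (boolPair (ones V) prm)).length = V * b ∧
      ∀ k < V, blockOf b k (segF g (boolPair (ones V) prm)) = g (boolPair (boolPair (ones V) prm) (ones k)) := by
  rw [segF_apply fun j hj => (hg j hj).le.trans hb]
  exact ⟨length_ccat_eq hg, fun k hk => blockOf_ccat hg hk⟩

/-! ### The fitted segment of the random matrix -/

/-- Piece of the fitted segment on `⟨⟨1^V, ⟨1^b, T⟩⟩, 1^k⟩`: block `k` of `T` (or zeros). [folklore] -/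
def fitPiece : List Bool → List Bool :=
  blockAtF ∘ fanoutFn (fanoutFn (nthF 1 ∘ fstF) (sndPow 1 ∘ fstF)) sndF

/-- **The fitted segment** `fitSegF ⟨1^V, ⟨1^b, T⟩⟩`: the first `V` blocks of `T 0^∞`.
[cite: BlaserIkenmeyerJindalLysikov2018, §6 (random evaluation over `𝔽_p`)] -/
def fitSegF : List Bool → List Bool := segF fitPiece

/-- `fitPiece ∈ FP`. [folklore] -/
private theorem fitPiece_mem_FP : fitPiece ∈ FP :=
  comp_mem_FP blockAtF_mem_FP (fanoutFn_mem_FP (fanoutFn_mem_FP (comp_mem_FP (nthF_mem_FP 1) fstF_mem_FP)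
    (comp_mem_FP (sndPow_mem_FP 1) fstF_mem_FP)) sndF_mem_FP)

/-- Value of `fitPiece`. [folklore] -/
private theorem fitPiece_apply (V b : ℕ) (T u : List Bool) :
    fitPiece (boolPair (boolPair (ones V) (boolPair (ones b) T)) u) = blockAtF (boolPair (boolPair (ones b) T) u) := by
  simp [fitPiece, nthF, sndPow]

/-- **`fitSegF ∈ FP`.** [cite: AroraBarakCC2009, §1.3] -/
theorem fitSegF_mem_FP : fitSegF ∈ FP := segF_mem_FP fitPiece_mem_FP

/-- **Specification of the fitted segment**: on `⟨1^V, ⟨1^b, T⟩⟩` with `|T| = m·b` it has length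
`V·b`, and its point (`ptOf b V`) has coordinate `i ↦ ⟦block i of T⟧` for `i < m`, `0` otherwise.
[cite: BlaserIkenmeyerJindalLysikov2018, §6 (random evaluation over `𝔽_p`)] -/
theorem ptOf_fitSegF {V b m : ℕ} {T : List Bool} (hT : T.length = m * b) :
    (fitSegF (boolPair (ones V) (boolPair (ones b) T))).length = V * b ∧
      ∀ i : Fin V, ptOf b V (fitSegF (boolPair (ones V) (boolPair (ones b) T))) i =
        if i.val < m then (bitsToNat (blockOf b i.val T) : ℤ) else 0 := by
  have hlen : ∀ j < V, (fitPiece (boolPair (boolPair (ones V) (boolPair (ones b) T)) (ones j))).length = b :=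
    fun j _ => by rw [fitPiece_apply, length_blockAtF, KIReduction.length_ones']
  have hb : b ≤ (boolPair (ones V) (boolPair (ones b) T)).length + 1 := by
    simp only [length_boolPair, KIReduction.length_ones']; omega
  obtain ⟨hL, hB⟩ := segF_blocks hb hlen
  refine ⟨hL, fun i => ?_⟩
  rw [ptOf, show segF fitPiece = fitSegF from rfl] at *
  rw [hB i.val i.isLt, fitPiece_apply, bitsToNat_blockAtF (m := m) (by rw [KIReduction.length_ones']; exact hT),
    KIReduction.length_ones', KIReduction.length_ones']
  split_ifs <;> simp

/-! ### The gathered segment of a minor -/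

/-- The `1ⁿ` field of the minor context `x = ⟨1^V, ⟨1^b, ⟨T, ⟨1^n, 1^j⟩⟩⟩⟩`, from `⟨x, u⟩`. [folklore] -/
private def mnF : List Bool → List Bool := nthF 3 ∘ fstF
/-- The `1^j` field of the minor context, from `⟨x, u⟩`. [folklore] -/
private def mjF : List Bool → List Bool := sndPow 3 ∘ fstF
/-- `⟨1^{k/n}, 1^{k%n}⟩` from `⟨x, 1^k⟩`. [folklore] -/
private def mdmF : List Bool → List Bool := divModFn ∘ fanoutFn mnF sndF

/-- **The source position of the minor gather in unary**: on `⟨x, 1^k⟩`,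
`1^{(k/n + 1)·n} ++ 1^{k % n} ++ [j ≤ k % n]` = `1^{minorSrc n j (k/n) (k%n)}`.
[cite: KabanetsImpagliazzo2003, Lemma 11 (2) (p. 358)] -/
def minorSrcF : List Bool → List Bool :=
  appF ∘ fanoutFn (umulFn ∘ fanoutFn (List.cons true ∘ fstF ∘ mdmF) mnF)
    (appF ∘ fanoutFn (sndF ∘ mdmF) (iteFn (ltLenF ∘ fanoutFn (sndF ∘ mdmF) mjF) (fun _ => []) (fun _ => [true])))

/-- Piece of the minor segment on `⟨x, 1^k⟩`: the block of `T` at the source position. [folklore] -/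
def minorPiece : List Bool → List Bool :=
  blockAtF ∘ fanoutFn (fanoutFn (nthF 1 ∘ fstF) (nthF 2 ∘ fstF)) minorSrcF

/-- **The minor segment** `minorSegF ⟨1^V, ⟨1^b, ⟨T, ⟨1^n, 1^j⟩⟩⟩⟩`: `V` blocks, block `k` = the block of
`T` at `minorSrc n j (k/n) (k%n)` (zeros past the end of `T`).
[cite: KabanetsImpagliazzo2003, Lemma 11 (2) (p. 358)] [cite: BlaserIkenmeyerJindalLysikov2018, §6] -/
def minorSegF : List Bool → List Bool := segF minorPiece

/-- `mdmF ∈ FP`. [folklore] -/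
private theorem mdmF_mem_FP : mdmF ∈ FP :=
  comp_mem_FP divModFn_mem_FP (fanoutFn_mem_FP (comp_mem_FP (nthF_mem_FP 3) fstF_mem_FP) sndF_mem_FP)

/-- `minorSrcF ∈ FP`. [cite: AroraBarakCC2009, §1.3] -/
theorem minorSrcF_mem_FP : minorSrcF ∈ FP :=
  comp_mem_FP appF_mem_FP (fanoutFn_mem_FP
    (comp_mem_FP umulFn_mem_FP (fanoutFn_mem_FP (comp_mem_FP (cons_mem_FP true) (comp_mem_FP fstF_mem_FP mdmF_mem_FP))
      (comp_mem_FP (nthF_mem_FP 3) fstF_mem_FP)))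
    (comp_mem_FP appF_mem_FP (fanoutFn_mem_FP (comp_mem_FP sndF_mem_FP mdmF_mem_FP)
      (iteFn_mem_FP (comp_mem_FP ltLenF_mem_FP (fanoutFn_mem_FP (comp_mem_FP sndF_mem_FP mdmF_mem_FP)
        (comp_mem_FP (sndPow_mem_FP 3) fstF_mem_FP))) (const_mem_FP _) (const_mem_FP _)))))

/-- `minorPiece ∈ FP`. [folklore] -/
private theorem minorPiece_mem_FP : minorPiece ∈ FP :=
  comp_mem_FP blockAtF_mem_FP (fanoutFn_mem_FP (fanoutFn_mem_FP (comp_mem_FP (nthF_mem_FP 1) fstF_mem_FP)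
    (comp_mem_FP (nthF_mem_FP 2) fstF_mem_FP)) minorSrcF_mem_FP)

/-- **`minorSegF ∈ FP`.** [cite: AroraBarakCC2009, §1.3] -/
theorem minorSegF_mem_FP : minorSegF ∈ FP := segF_mem_FP minorPiece_mem_FP

/-- Value of `mdmF` on the minor context. [folklore] -/
private theorem mdmF_mctx (V b n j k : ℕ) (T : List Bool) :
    mdmF (boolPair (boolPair (ones V) (boolPair (ones b) (boolPair T (boolPair (ones n) (ones j))))) (ones k)) =
      boolPair (ones (k / n)) (ones (k % n)) := by
  simp [mdmF, mnF, nthF]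

/-- **Value of the source brick**: `|minorSrcF ⟨x, 1^k⟩| = minorSrc n j (k / n) (k % n)`.
[cite: KabanetsImpagliazzo2003, Lemma 11 (2) (p. 358)] -/
theorem length_minorSrcF (V b n j k : ℕ) (T : List Bool) :
    (minorSrcF (boolPair (boolPair (ones V) (boolPair (ones b) (boolPair T (boolPair (ones n) (ones j))))) (ones k))).length =
      PermanentChain.minorSrc n j (k / n) (k % n) := by
  have hlt : (ltLenF ∘ fanoutFn (sndF ∘ mdmF) mjF) (boolPair (boolPair (ones V) (boolPair (ones b) (boolPair T (boolPair (ones n) (ones j))))) (ones k)) =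
      [decide (k % n < j)] := by
    simp only [Function.comp_apply, fanoutFn_apply, mdmF_mctx, sndF_boolPair, ltLenF_boolPair, KIReduction.length_ones']
    simp [mjF, sndPow]
  have hn : mnF (boolPair (boolPair (ones V) (boolPair (ones b) (boolPair T (boolPair (ones n) (ones j))))) (ones k)) = ones n := by
    simp [mnF, nthF]
  rw [minorSrcF, Function.comp_apply, fanoutFn_apply, appF_boolPair, List.length_append]
  simp only [Function.comp_apply, fanoutFn_apply, mdmF_mctx, fstF_boolPair, sndF_boolPair, appF_boolPair,
    umulFn_apply, List.length_append, List.length_cons, KIReduction.length_ones', iteFn_apply hlt, hn,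
    PermanentChain.minorSrc]
  by_cases h : k % n < j
  · rw [if_neg (not_le.2 h)]; simp [h]
  · rw [if_pos (not_lt.1 h)]; simp [h]; ring

/-- Value of `minorPiece` on the minor context. [folklore] -/
private theorem minorPiece_apply (V b n j k : ℕ) (T : List Bool) :
    minorPiece (boolPair (boolPair (ones V) (boolPair (ones b) (boolPair T (boolPair (ones n) (ones j))))) (ones k)) =
      blockAtF (boolPair (boolPair (ones b) T) (minorSrcF (boolPair (boolPair (ones V) (boolPair (ones b) (boolPair T (boolPair (ones n) (ones j))))) (ones k)))) := by
  simp [minorPiece, nthF]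

/-- **Specification of the minor segment**: on `⟨1^V, ⟨1^b, ⟨T, ⟨1^n, 1^j⟩⟩⟩⟩` with `|T| = m·b` it has
length `V·b`, and its point has coordinate `i ↦ ⟦block (minorSrc n j (i/n) (i%n)) of T⟧` when that
source position is `< m`, `0` otherwise. [cite: KabanetsImpagliazzo2003, Lemma 11 (2) (p. 358)]
[cite: BlaserIkenmeyerJindalLysikov2018, §6 (random evaluation over `𝔽_p`)] -/
theorem ptOf_minorSegF {V b m n j : ℕ} {T : List Bool} (hT : T.length = m * b) :
    (minorSegF (boolPair (ones V) (boolPair (ones b) (boolPair T (boolPair (ones n) (ones j)))))).length = V * b ∧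
      ∀ i : Fin V, ptOf b V (minorSegF (boolPair (ones V) (boolPair (ones b) (boolPair T (boolPair (ones n) (ones j)))))) i =
        if PermanentChain.minorSrc n j (i.val / n) (i.val % n) < m then
          (bitsToNat (blockOf b (PermanentChain.minorSrc n j (i.val / n) (i.val % n)) T) : ℤ) else 0 := by
  have hlen : ∀ k < V, (minorPiece (boolPair (boolPair (ones V) (boolPair (ones b) (boolPair T (boolPair (ones n) (ones j))))) (ones k))).length = b :=
    fun k _ => by rw [minorPiece_apply, length_blockAtF, KIReduction.length_ones']
  have hb : b ≤ (boolPair (ones V) (boolPair (ones b) (boolPair T (boolPair (ones n) (ones j))))).length + 1 := by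
    simp only [length_boolPair, KIReduction.length_ones']; omega
  obtain ⟨hL, hB⟩ := segF_blocks (prm := boolPair (ones b) (boolPair T (boolPair (ones n) (ones j)))) hb hlen
  refine ⟨hL, fun i => ?_⟩
  rw [ptOf, show segF minorPiece = minorSegF from rfl] at *
  rw [hB i.val i.isLt, minorPiece_apply, bitsToNat_blockAtF (m := m) (by rw [KIReduction.length_ones']; exact hT),
    KIReduction.length_ones', length_minorSrcF]
  split_ifs <;> simp

/-! ### The segment of the input `0/1` matrix -/

/-- `⟨1^{k/n}, 1^{k%n}⟩` from `⟨x, 1^k⟩`, `x = ⟨1^V, ⟨1^b, ⟨rows, 1^n⟩⟩⟩`. [folklore] -/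
private def edmF : List Bool → List Bool := divModFn ∘ fanoutFn (sndPow 2 ∘ fstF) sndF

/-- **The entry bit** on `⟨x, 1^k⟩`: `[entryStr rows (k/n) (k%n) = intCode 1]` (the test inside
`KIReduction.constOpF`). [cite: KabanetsImpagliazzo2003, proof of Cor. 12 (p. 358)] -/
def entryBitF : List Bool → List Bool :=
  eqPairFn ∘ fanoutFn (nthItemFn ∘ fanoutFn (sndF ∘ edmF) (sndF ∘ nthItemFn ∘ fanoutFn (fstF ∘ edmF) (nthF 2 ∘ fstF)))
    (fun _ => QuantumComplexity.BosonCodes.intCode 1)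

/-- `[k < n²]` on `⟨x, 1^k⟩`. [folklore] -/
private def einF : List Bool → List Bool :=
  ltLenF ∘ fanoutFn sndF (umulFn ∘ fanoutFn (sndPow 2 ∘ fstF) (sndPow 2 ∘ fstF))

/-- Piece of the entry segment on `⟨x, 1^k⟩`: `[entry bit] 0^{b-1}` for `k < n²`, else `0^b`. [folklore] -/
def entryPiece : List Bool → List Bool :=
  iteFn einF (appF ∘ fanoutFn entryBitF (Kannan.zerosFn ∘ List.tail ∘ nthF 1 ∘ fstF)) (Kannan.zerosFn ∘ nthF 1 ∘ fstF)

/-- **The entry segment** `entrySegF ⟨1^V, ⟨1^b, ⟨rows, 1^n⟩⟩⟩`: `V` blocks of `b` bits, block `k < n²`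
holding the parsed `0/1` entry `(k/n, k%n)` of the instance matrix, zeros elsewhere.
[cite: KabanetsImpagliazzo2003, proof of Cor. 12 (p. 358)] [cite: BlaserIkenmeyerJindalLysikov2018, §6] -/
def entrySegF : List Bool → List Bool := segF entryPiece

/-- `edmF ∈ FP`. [folklore] -/
private theorem edmF_mem_FP : edmF ∈ FP :=
  comp_mem_FP divModFn_mem_FP (fanoutFn_mem_FP (comp_mem_FP (sndPow_mem_FP 2) fstF_mem_FP) sndF_mem_FP)

/-- `entryBitF ∈ FP`. [cite: AroraBarakCC2009, §1.3] -/
theorem entryBitF_mem_FP : entryBitF ∈ FP :=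
  comp_mem_FP eqPairFn_mem_FP (fanoutFn_mem_FP
    (comp_mem_FP nthItemFn_mem_FP (fanoutFn_mem_FP (comp_mem_FP sndF_mem_FP edmF_mem_FP)
      (comp_mem_FP sndF_mem_FP (comp_mem_FP nthItemFn_mem_FP (fanoutFn_mem_FP (comp_mem_FP fstF_mem_FP edmF_mem_FP)
        (comp_mem_FP (nthF_mem_FP 2) fstF_mem_FP))))))
    (const_mem_FP _))

/-- `einF ∈ FP`. [folklore] -/
private theorem einF_mem_FP : einF ∈ FP :=
  comp_mem_FP ltLenF_mem_FP (fanoutFn_mem_FP sndF_mem_FP (comp_mem_FP umulFn_mem_FP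
    (fanoutFn_mem_FP (comp_mem_FP (sndPow_mem_FP 2) fstF_mem_FP) (comp_mem_FP (sndPow_mem_FP 2) fstF_mem_FP))))

/-- `entryPiece ∈ FP`. [folklore] -/
private theorem entryPiece_mem_FP : entryPiece ∈ FP :=
  iteFn_mem_FP einF_mem_FP
    (comp_mem_FP appF_mem_FP (fanoutFn_mem_FP entryBitF_mem_FP
      (comp_mem_FP Kannan.zerosFn_mem_FP (comp_mem_FP tail_mem_FP (comp_mem_FP (nthF_mem_FP 1) fstF_mem_FP)))))
    (comp_mem_FP Kannan.zerosFn_mem_FP (comp_mem_FP (nthF_mem_FP 1) fstF_mem_FP))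

/-- **`entrySegF ∈ FP`.** [cite: AroraBarakCC2009, §1.3] -/
theorem entrySegF_mem_FP : entrySegF ∈ FP := segF_mem_FP entryPiece_mem_FP

/-- Value of `edmF` on the entry context. [folklore] -/
private theorem edmF_ectx (V b n k : ℕ) (rows : List Bool) :
    edmF (boolPair (boolPair (ones V) (boolPair (ones b) (boolPair rows (ones n)))) (ones k)) = boolPair (ones (k / n)) (ones (k % n)) := by
  simp [edmF, sndPow]

/-- **Value of the entry bit**: `[entryStr rows (k/n) (k%n) = intCode 1]`.
[cite: KabanetsImpagliazzo2003, proof of Cor. 12 (p. 358)] -/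
theorem entryBitF_apply (V b n k : ℕ) (rows : List Bool) :
    entryBitF (boolPair (boolPair (ones V) (boolPair (ones b) (boolPair rows (ones n)))) (ones k)) =
      [decide (KIReduction.entryStr rows (k / n) (k % n) = QuantumComplexity.BosonCodes.intCode 1)] := by
  simp only [entryBitF, Function.comp_apply, fanoutFn_apply, edmF_ectx, sndF_boolPair, fstF_boolPair,
    nthItemFn_boolPair, KIReduction.length_ones', eqPairFn_boolPair, KIReduction.entryStr]
  simp [nthF]

/-- Value of `entryPiece` on the entry context. [folklore] -/
private theorem entryPiece_apply (V b n k : ℕ) (rows : List Bool) :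
    entryPiece (boolPair (boolPair (ones V) (boolPair (ones b) (boolPair rows (ones n)))) (ones k)) =
      if k < n * n then
        decide (KIReduction.entryStr rows (k / n) (k % n) = QuantumComplexity.BosonCodes.intCode 1) ::
          List.replicate (b - 1) false
      else List.replicate b false := by
  have hin : einF (boolPair (boolPair (ones V) (boolPair (ones b) (boolPair rows (ones n)))) (ones k)) = [decide (k < n * n)] := by
    simp [einF, sndPow, umulFn_apply]
  rw [entryPiece, iteFn_apply hin]
  by_cases h : k < n * n
  · rw [if_pos (decide_eq_true h), if_pos h, Function.comp_apply, fanoutFn_apply, appF_boolPair, entryBitF_apply]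
    simp [nthF, Kannan.zerosFn_apply, ones]
  · rw [if_neg (by simp [h]), if_neg h]
    simp [nthF, Kannan.zerosFn_apply]

/-- The length of an entry piece is `b` (`b ≥ 1`). [folklore] -/
private theorem length_entryPiece {b : ℕ} (hb : 1 ≤ b) (V n k : ℕ) (rows : List Bool) :
    (entryPiece (boolPair (boolPair (ones V) (boolPair (ones b) (boolPair rows (ones n)))) (ones k))).length = b := by
  rw [entryPiece_apply]
  split_ifs
  · rw [List.length_cons, List.length_replicate]; omega
  · rw [List.length_replicate]

/-- The value of a bit followed by zeros. [folklore] -/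
private theorem bitsToNat_cons_replicate (c : Bool) (t : ℕ) :
    bitsToNat (c :: List.replicate t false) = if c then 1 else 0 := by
  have h0 : bitsToNat (List.replicate t false) = 0 := by
    induction t with
    | zero => rfl
    | succ t ih => rw [List.replicate_succ]; simp [bitsToNat, ih]
  cases c <;> simp [bitsToNat, h0]

/-- **Specification of the entry segment**: on `⟨1^V, ⟨1^b, ⟨rows, 1^n⟩⟩⟩` (`b ≥ 1`) it has length
`V·b`, and its point has coordinate `i ↦ parsedEntry rows (i/n) (i%n)` for `i < n²`, `0` otherwise.
[cite: KabanetsImpagliazzo2003, proof of Cor. 12 (p. 358)] [cite: BlaserIkenmeyerJindalLysikov2018, §6] -/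
theorem ptOf_entrySegF {V b n : ℕ} (hb : 1 ≤ b) (rows : List Bool) :
    (entrySegF (boolPair (ones V) (boolPair (ones b) (boolPair rows (ones n))))).length = V * b ∧
      ∀ i : Fin V, ptOf b V (entrySegF (boolPair (ones V) (boolPair (ones b) (boolPair rows (ones n))))) i =
        if i.val < n * n then KIReduction.parsedEntry rows (i.val / n) (i.val % n) else 0 := by
  have hlen : ∀ k < V, (entryPiece (boolPair (boolPair (ones V) (boolPair (ones b) (boolPair rows (ones n)))) (ones k))).length = b :=
    fun k _ => length_entryPiece hb V n k rows
  have hb' : b ≤ (boolPair (ones V) (boolPair (ones b) (boolPair rows (ones n)))).length + 1 := by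
    simp only [length_boolPair, KIReduction.length_ones']; omega
  obtain ⟨hL, hB⟩ := segF_blocks (prm := boolPair (ones b) (boolPair rows (ones n))) hb' hlen
  refine ⟨hL, fun i => ?_⟩
  rw [ptOf, show segF entryPiece = entrySegF from rfl] at *
  rw [hB i.val i.isLt, entryPiece_apply]
  by_cases h : i.val < n * n
  · rw [if_pos h, if_pos h, bitsToNat_cons_replicate, KIReduction.parsedEntry]
    by_cases he : KIReduction.entryStr rows (i.val / n) (i.val % n) = QuantumComplexity.BosonCodes.intCode 1
    · simp [he]
    · simp [he]
  · rw [if_neg h, if_neg h]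
    have h0 : ∀ t : ℕ, bitsToNat (List.replicate t false) = 0 := by
      intro t
      induction t with
      | zero => rfl
      | succ t ih => rw [List.replicate_succ]; simp [bitsToNat, ih]
    simp [h0]

end PointSeg

end Literature.Computability.AlgebraicComplexity

end
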